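import Summits.QuantumFields.YangMills.Theorems.CurvatureBoostCovariance.Negative.Unbundled
import Summits.QuantumFields.YangMills.Theorems.NPointIsotropy.Negative.TieLoadBearing
import Summits.QuantumFields.YangMills.Theorems.PencilRigidityNPointIsotropyOneAngleCircle
import Summits.QuantumFields.YangMills.Theorems.PencilRigidityNPointIsotropyOneAngleAxis
import Summits.QuantumFields.YangMills.Theorems.LangevinControlUVOSLegsFromFemtoAndGapStubUpgrade

/-!
# Stub `stub_oneAngleAmplification` of crux `PencilRigidity.NPointIsotropy`, line `quarter-turn-corner-operator`

Stub F of the lead's skeleton `Cruxes/NPointIsotropy/Lines/quarter-turn-corner-operator.lean` (crux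
`stmt-QuantumFields-11686`, `Summit.QuantumFields.YangMills.Theses.PencilRigidity.NPointIsotropy`): **one-angle
amplification.** For a one-species Schwinger family `S₁` on `ℝ⁴`, invariance on `⁰𝒮` (off-diagonal test functions)
under the proper signed permutations `W(B₄) ∩ SO(4)` (`Hypercubic S₁`) together with invariance under ONE rotation by
`π/4` of the `(x₀,x₁)`-plane (every `R₈` with `R₈ e₀ = (e₀+e₁)/√2`, `R₈ e₁ = (-e₀+e₁)/√2`, `e₂, e₃` fixed) forces
invariance on `⁰𝒮` under every determinant-one isometry fixing `e₂, e₃` (`PlanarInvariant S₁`).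

Proof. Apply the pure-geometry files to the invariance predicate
`P A := ∀ n F, IsOffDiagonal F → 𝔖ₙ(A · F) = 𝔖ₙ(F)`:
* `P` is closed under composition and inverses (`linActMulti` is an action preserving `⁰𝒮`; tree
  `Upgrade.linActMulti_trans_eq`, `Upgrade.isOffDiagonal_linActMulti`), holds on the proper signed permutations
  (`Hypercubic`) and on the eighth-turns (hypothesis);
* **closedness** (the only analytic input): for isometries `A, B` the set `{t | P (A ∘ ρ t ∘ B)}` is closed, because
  `A · (ρ t · (B · F))` depends continuously on `t` in `𝓢` (tree `Upgrade.continuous_linActMulti_rho`, from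
  `SchwartzMap.continuous_compCLMOfContinuousLinearEquiv_apply`) and each `𝔖ₙ` is continuous;
* `oneAngleCircle` (file II; closed subgroups of `ℝ`, the irrational skew rotation `Q_A ∘ R₈` of file I) gives `P` on
  the circle group about `v = e₀ + (1+√2) e₁ + e₂`, and `oneAngleAxis` (file III; intermediate value theorem on a
  second circle) moves it to the coordinate circle `SO(2)₀₁ = Stab(e₂, e₃)`.

The statement is the registered signature of `stub_oneAngleAmplification` verbatim. References: folklore.
-/

noncomputable section

namespace Summit.QuantumFields.YangMills.Theorems.NPointIsotropy.QuarterTurnCornerOperator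

open scoped SchwartzMap
open Literature.MathematicalPhysics.QuantumLattice Literature.MathematicalPhysics.AQFT
  Literature.MathematicalPhysics.QuantumFieldTheory
open Summit.QuantumFields.YangMills.Theorems.NPointIsotropy.Negative (E4)
open Summit.QuantumFields.YangMills.Theorems.CurvatureBoostCovariance.Negative (Hypercubic PlanarInvariant)
open Summit.QuantumFields.YangMills.Theorems.OSLegsFromFemtoAndGap.Upgrade
  (isOffDiagonal_linActMulti linActMulti_trans_eq linActMulti_refl_eq continuous_linActMulti_rho)

namespace OneAngle

/-- **The invariance predicate of a family on `⁰𝒮` is closed along conjugate families of plane rotations**: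
`{t | ∀ n F, F ∈ ⁰𝒮 → 𝔖ₙ((A ∘ ρ t ∘ B) · F) = 𝔖ₙ(F)}` is closed (continuity of `t ↦ ρ t · F'` in `𝓢`). [folklore] -/
theorem isClosed_setOf_invariant (S₁ : SchwingerFamily E4) (A B : E4 ≃ₗᵢ[ℝ] E4) :
    IsClosed {t : ℝ | ∀ (n : ℕ) (F : 𝓢((Fin n → E4), ℂ)), IsOffDiagonal F →
      S₁ n (linActMulti ((A.trans (planeRot (d := 3) 0 t)).trans B) F) = S₁ n F} := by
  have h : IsClosed (⋂ (n : ℕ), ⋂ (F : 𝓢((Fin n → E4), ℂ)), ⋂ (_ : IsOffDiagonal F),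
      {t : ℝ | S₁ n (linActMulti ((A.trans (planeRot (d := 3) 0 t)).trans B) F) = S₁ n F}) := by
    refine isClosed_iInter fun n => isClosed_iInter fun F => isClosed_iInter fun _ => ?_
    have hc : Continuous fun t : ℝ => S₁ n (linActMulti ((A.trans (planeRot (d := 3) 0 t)).trans B) F) := by
      have he : (fun t : ℝ => S₁ n (linActMulti ((A.trans (planeRot (d := 3) 0 t)).trans B) F)) =
          fun t => S₁ n (linActMulti B (linActMulti (planeRot (d := 3) 0 t : E4 ≃ₗᵢ[ℝ] E4) (linActMulti A F))) := by
        funext t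
        rw [linActMulti_trans_eq, linActMulti_trans_eq]
      rw [he]
      exact (S₁ n).continuous.comp ((linActMulti B).continuous.comp (continuous_linActMulti_rho (linActMulti A F)))
    exact isClosed_eq hc continuous_const
  convert h using 1
  ext t
  simp only [Set.mem_setOf_eq, Set.mem_iInter]

end OneAngle

/-- **Stub F `stub_oneAngleAmplification` (one-angle amplification).** Invariance on `⁰𝒮` under the proper signed
permutations and under one rotation by `π/4` of the `(x₀,x₁)`-plane forces invariance under every determinant-one
isometry fixing `e₂, e₃`: the invariance predicate is a group closed along plane-rotation families
(`OneAngle.isClosed_setOf_invariant`), so `oneAngleCircle` and `oneAngleAxis` apply. [folklore] -/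
theorem stub_oneAngleAmplification :
    open Literature.MathematicalPhysics.QuantumLattice Literature.MathematicalPhysics.AQFT
      Summit.QuantumFields.YangMills.Theorems.CurvatureBoostCovariance.Negative
      Summit.QuantumFields.YangMills.Theorems.NPointIsotropy.Negative in
    ∀ (S₁ : SchwingerFamily E4), Hypercubic S₁ →
      (∀ R₈ : E4 ≃ₗᵢ[ℝ] E4,
        (R₈ (EuclideanSpace.single 0 1) =
            (Real.sqrt 2 / 2) • EuclideanSpace.single 0 1 + (Real.sqrt 2 / 2) • EuclideanSpace.single 1 1 ∧
          R₈ (EuclideanSpace.single 1 1) =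
            -((Real.sqrt 2 / 2) • EuclideanSpace.single 0 1) + (Real.sqrt 2 / 2) • EuclideanSpace.single 1 1 ∧
          R₈ (EuclideanSpace.single 2 1) = EuclideanSpace.single 2 1 ∧
          R₈ (EuclideanSpace.single 3 1) = EuclideanSpace.single 3 1) →
        ∀ (n : ℕ) (F : SchwartzMap (Fin n → E4) ℂ), IsOffDiagonal F → S₁ n (linActMulti R₈ F) = S₁ n F) →
      PlanarInvariant S₁ := by
  intro S₁ hhyp h8
  unfold PlanarInvariant
  intro R hR hR2 hR3
  -- the invariance predicate on `⁰𝒮`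
  have hmul : ∀ A B : E4 ≃ₗᵢ[ℝ] E4,
      (∀ (n : ℕ) (F : 𝓢((Fin n → E4), ℂ)), IsOffDiagonal F → S₁ n (linActMulti A F) = S₁ n F) →
      (∀ (n : ℕ) (F : 𝓢((Fin n → E4), ℂ)), IsOffDiagonal F → S₁ n (linActMulti B F) = S₁ n F) →
      ∀ (n : ℕ) (F : 𝓢((Fin n → E4), ℂ)), IsOffDiagonal F → S₁ n (linActMulti (A.trans B) F) = S₁ n F := by
    intro A B hA hB n F hF
    rw [linActMulti_trans_eq, hB n _ (isOffDiagonal_linActMulti A hF), hA n F hF]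
  have hinv : ∀ A : E4 ≃ₗᵢ[ℝ] E4,
      (∀ (n : ℕ) (F : 𝓢((Fin n → E4), ℂ)), IsOffDiagonal F → S₁ n (linActMulti A F) = S₁ n F) →
      ∀ (n : ℕ) (F : 𝓢((Fin n → E4), ℂ)), IsOffDiagonal F → S₁ n (linActMulti A.symm F) = S₁ n F := by
    intro A hA n F hF
    have h := hA n _ (isOffDiagonal_linActMulti A.symm hF)
    rw [← linActMulti_trans_eq, LinearIsometryEquiv.symm_trans_self, linActMulti_refl_eq] at h
    exact h.symm
  have hcirc := oneAngleCircle
    (fun A : E4 ≃ₗᵢ[ℝ] E4 => ∀ (n : ℕ) (F : 𝓢((Fin n → E4), ℂ)), IsOffDiagonal F → S₁ n (linActMulti A F) = S₁ n F)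
    hmul hinv hhyp h8 (fun A B => OneAngle.isClosed_setOf_invariant S₁ A B)
  exact oneAngleAxis
    (fun A : E4 ≃ₗᵢ[ℝ] E4 => ∀ (n : ℕ) (F : 𝓢((Fin n → E4), ℂ)), IsOffDiagonal F → S₁ n (linActMulti A F) = S₁ n F)
    hmul hinv hhyp hcirc R hR hR2 hR3

end Summit.QuantumFields.YangMills.Theorems.NPointIsotropy.QuarterTurnCornerOperator

end
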